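import Mathlib
import Literature.NumberTheory.Transcendental.LinEDS
import Literature.NumberTheory.Transcendental.LinEDSCode
import HarnessLib

/-!
# `KernelModuloPeriodConjecture`, line `Sketch`: the engine's columns and Hoffman words (E8)

Crux `FurushoPentagon.KernelModuloPeriodConjecture` (stmt-KontsevichZagierPeriods-15058), line
`Sketch`, registered stub `stub_cols_spec` of the lead's skeleton v11: the specification of the
column list `LinEDS.cols k`, of the Hoffman enumeration `LinEDS.hofLists k` and of the masks
`LinEDS.hofMask k`, `LinEDS.colMask k` of the kernel-checkable GF(2) rank engine for the linearised
extended double shuffle system (`Literature/NumberTheory/Transcendental/LinEDS.lean`): the columns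
are, strictly increasingly, exactly the odd codes `c < 2^(k-1)` (the admissible binary words of
weight `k`) whose word is not the binary word of a Hoffman index; `hofLists k` lists exactly the
Hoffman indices of weight `k`. Elementary list/bit bookkeeping.

References: M. E. Hoffman, J. Algebra 194 (1997) §1 [Hoffman1997]; K. Ihara, M. Kaneko, D. Zagier,
Compos. Math. 142 (2006) §2 [IharaKanekoZagier2006].
-/

namespace Summit.KontsevichZagierPeriods.FurushoPentagon.KernelModuloPeriodConjecture

open Literature.NumberTheory.Transcendental
open Literature.NumberTheory.Transcendental.LinEDS

/-- `hofLists k` lists exactly the Hoffman indices (entries in `{2,3}`) of weight `k`.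
[cite: Hoffman1997, §1] -/
theorem colsE8_mem_hofLists_iff : ∀ (k : ℕ) (t : List ℕ),
    t ∈ LinEDS.hofLists k ↔ MZV.IsHoffman t ∧ t.sum = k
  | 0, t => by
    rw [LinEDS.hofLists]
    constructor
    · intro h
      rw [List.mem_singleton] at h
      subst h
      exact ⟨fun i hi => by simp at hi, rfl⟩
    · rintro ⟨hH, hs⟩
      cases t with
      | nil => simp
      | cons a t => have := hH a (by simp); simp [List.sum_cons] at hs; omega
  | 1, t => by
    rw [LinEDS.hofLists]
    simp only [List.not_mem_nil, false_iff, not_and]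
    intro hH hs
    cases t with
    | nil => simp at hs
    | cons a t => have := hH a (by simp); simp [List.sum_cons] at hs; omega
  | 2, t => by
    rw [LinEDS.hofLists]
    constructor
    · simp only [List.mem_singleton]
      rintro rfl
      exact ⟨fun i hi => by simp at hi; omega, rfl⟩
    · rintro ⟨hH, hs⟩
      cases t with
      | nil => simp at hs
      | cons a t =>
        have ha := hH a (by simp)
        simp only [List.sum_cons] at hs
        cases t with
        | nil => simp at hs ⊢; omega
        | cons b t => have hb := hH b (by simp); simp [List.sum_cons] at hs; omega
  | n + 3, t => by
    rw [LinEDS.hofLists, List.mem_append, List.mem_map, List.mem_map]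
    constructor
    · rintro (⟨t', ht', rfl⟩ | ⟨t', ht', rfl⟩)
      · obtain ⟨hH, hs⟩ := (colsE8_mem_hofLists_iff (n + 1) t').mp ht'
        exact ⟨fun i hi => by
          rcases List.mem_cons.mp hi with rfl | hi
          · exact Or.inl rfl
          · exact hH i hi, by simp [List.sum_cons, hs]; omega⟩
      · obtain ⟨hH, hs⟩ := (colsE8_mem_hofLists_iff n t').mp ht'
        exact ⟨fun i hi => by
          rcases List.mem_cons.mp hi with rfl | hi
          · exact Or.inr rfl
          · exact hH i hi, by simp [List.sum_cons, hs]; omega⟩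
    · rintro ⟨hH, hs⟩
      cases t with
      | nil => simp at hs
      | cons a t' =>
        have ht' : MZV.IsHoffman t' := fun i hi => hH i (by simp [hi])
        simp only [List.sum_cons] at hs
        rcases hH a (by simp) with rfl | rfl
        · exact Or.inl ⟨t', (colsE8_mem_hofLists_iff (n + 1) t').mpr ⟨ht', by omega⟩, rfl⟩
        · exact Or.inr ⟨t', (colsE8_mem_hofLists_iff n t').mpr ⟨ht', by omega⟩, rfl⟩

/-- Bits of an `|||`-fold of powers of two: `foldr`. [folklore] -/
theorem colsE8_testBit_foldr_lor {α : Type*} (f : α → ℕ) (l : List α) (i : ℕ) :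
    (l.foldr (fun a m => m ||| 2 ^ f a) 0).testBit i = true ↔ ∃ a ∈ l, f a = i := by
  induction l with
  | nil => simp
  | cons a l ih =>
    simp only [List.foldr_cons, Nat.testBit_lor, Nat.testBit_two_pow, Bool.or_eq_true,
      decide_eq_true_eq, List.mem_cons, exists_eq_or_imp]
    rw [ih, or_comm]

/-- Bits of an `|||`-fold of powers of two: `foldl` with an accumulator. [folklore] -/
theorem colsE8_testBit_foldl_lor (l : List ℕ) (m₀ i : ℕ) :
    (l.foldl (fun m c => m ||| 2 ^ c) m₀).testBit i = true ↔ m₀.testBit i = true ∨ i ∈ l := by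
  induction l generalizing m₀ with
  | nil => simp
  | cons c l ih =>
    rw [List.foldl_cons, ih]
    simp only [Nat.testBit_lor, Nat.testBit_two_pow, Bool.or_eq_true, decide_eq_true_eq,
      List.mem_cons]
    tauto

/-- The bits of `hofMask k` are the `icode`s of the Hoffman indices of weight `k`.
[cite: Hoffman1997, §1] -/
theorem colsE8_testBit_hofMask (k i : ℕ) :
    (LinEDS.hofMask k).testBit i = true ↔ ∃ t, MZV.IsHoffman t ∧ t.sum = k ∧ LinEDS.icode t = i := by
  rw [LinEDS.hofMask, colsE8_testBit_foldr_lor]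
  constructor
  · rintro ⟨t, ht, rfl⟩
    exact ⟨t, ((colsE8_mem_hofLists_iff k t).mp ht).1, ((colsE8_mem_hofLists_iff k t).mp ht).2, rfl⟩
  · rintro ⟨t, hH, hs, rfl⟩
    exact ⟨t, (colsE8_mem_hofLists_iff k t).mpr ⟨hH, hs⟩, rfl⟩

/-- A Hoffman index has positive entries. [folklore] -/
theorem colsE8_pos_of_isHoffman {t : List ℕ} (h : MZV.IsHoffman t) : ∀ a ∈ t, 1 ≤ a :=
  fun a ha => by rcases h a ha with rfl | rfl <;> omega

/-- For `c < 2^(k-1)` (`2 ≤ k`): `c` is the `icode` of a Hoffman index of weight `k` iff the word of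
`c` is the binary word of a Hoffman index. [cite: Hoffman1997, §1] -/
theorem colsE8_hoffman_iff {k c : ℕ} (hk : 2 ≤ k) (hc : c < 2 ^ (k - 1)) :
    (∃ t, MZV.IsHoffman t ∧ t.sum = k ∧ LinEDS.icode t = c) ↔
      ∃ t : List ℕ, MZV.IsHoffman t ∧ MZV.binaryWord t = LinEDS.wordOfCode k c := by
  have hck : c < 2 ^ k := lt_of_lt_of_le hc (Nat.pow_le_pow_right (by norm_num) (by omega))
  constructor
  · rintro ⟨t, hH, hs, rfl⟩
    refine ⟨t, hH, ?_⟩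
    have hpos := colsE8_pos_of_isHoffman hH
    rw [icode_eq_code_binaryWord hpos, ← hs, ← MZV.weight, ← MZV.length_binaryWord hpos,
      wordOfCode_code]
  · rintro ⟨t, hH, hw⟩
    have hpos := colsE8_pos_of_isHoffman hH
    refine ⟨t, hH, ?_, ?_⟩
    · have := congrArg List.length hw
      rwa [MZV.length_binaryWord hpos, length_wordOfCode] at this
    · rw [icode_eq_code_binaryWord hpos, hw, code_wordOfCode hck]

/-- Membership in `cols k` (`2 ≤ k`): odd codes below `2^(k-1)` off the Hoffman mask.
[cite: IharaKanekoZagier2006, §2] -/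
theorem colsE8_mem_cols_iff {k : ℕ} (hk : 2 ≤ k) (c : ℕ) :
    c ∈ LinEDS.cols k ↔ c < 2 ^ (k - 1) ∧ c % 2 = 1 ∧ (LinEDS.hofMask k).testBit c = false := by
  rw [LinEDS.cols, List.mem_filter, List.mem_map]
  simp only [List.mem_range, Bool.not_eq_eq_eq_not, Bool.not_true]
  have h2 : 2 ^ (k - 1) = 2 * 2 ^ (k - 2) := by
    rw [← Nat.pow_succ']; congr 1; omega
  constructor
  · rintro ⟨⟨i, hi, rfl⟩, hm⟩
    exact ⟨by omega, by omega, by simpa using hm⟩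
  · rintro ⟨hc, hodd, hm⟩
    exact ⟨⟨c / 2, by omega, by omega⟩, by simpa using hm⟩

/-- **Registered stub `stub_cols_spec`** (E8) of the lead's skeleton v11 (crux
stmt-KontsevichZagierPeriods-15058, line `Sketch`): the columns of the engine are, strictly
increasingly, exactly the odd codes `c < 2^(k-1)` whose word is not a Hoffman binary word;
`hofLists k` is exactly the Hoffman indices of weight `k`; `colMask k` has exactly the column bits.
[cite: Hoffman1997, §1] -/
theorem stub_cols_spec :
    ∀ k : ℕ, 2 ≤ k →
      (LinEDS.cols k).Pairwise (· < ·) ∧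
      (∀ c, c ∈ LinEDS.cols k ↔ c < 2 ^ (k - 1) ∧ c % 2 = 1 ∧
        ¬ ∃ t : List ℕ, MZV.IsHoffman t ∧ MZV.binaryWord t = LinEDS.wordOfCode k c) ∧
      (∀ t : List ℕ, t ∈ LinEDS.hofLists k ↔ MZV.IsHoffman t ∧ MZV.weight t = k) ∧
      (∀ i, (LinEDS.colMask k).testBit i = true ↔ i ∈ LinEDS.cols k) := by
  intro k hk
  refine ⟨?_, fun c => ?_, fun t => colsE8_mem_hofLists_iff k t, fun i => ?_⟩
  · -- strictly increasing: a filter of a strictly monotone image of `List.range`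
    rw [LinEDS.cols]
    refine List.Pairwise.filter _ ?_
    refine (List.pairwise_lt_range).map _ fun a b h => ?_
    omega
  · rw [colsE8_mem_cols_iff hk]
    constructor
    · rintro ⟨hc, hodd, hm⟩
      refine ⟨hc, hodd, fun h => ?_⟩
      have := (colsE8_testBit_hofMask k c).mpr ((colsE8_hoffman_iff hk hc).mpr h)
      rw [hm] at this
      exact Bool.false_ne_true this
    · rintro ⟨hc, hodd, hn⟩
      refine ⟨hc, hodd, ?_⟩
      cases h : (LinEDS.hofMask k).testBit c
      · rfl
      · exact absurd ((colsE8_hoffman_iff hk hc).mp ((colsE8_testBit_hofMask k c).mp h)) hn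
  · rw [LinEDS.colMask, colsE8_testBit_foldl_lor]
    simp

end Summit.KontsevichZagierPeriods.FurushoPentagon.KernelModuloPeriodConjecture
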